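import Literature.NumberTheory.Automorphic.UnitaryGroupCohomologicalForms
import HarnessLib

/-!
# The Hodge splitting of a cohomological cotangent form inside a discrete automorphic representation (junction letter J0)

Topic `NumberTheory/Automorphic`; namespace `Literature.NumberTheory.Automorphic.UnitaryGroup.CotangentForms`.  STATEMENT-ONLY: one
closed named fact `def … : Prop`; imports ★ `UnitaryGroupCohomologicalForms` (the generic carriers `holCotForms`, `cohForms`,
`conjFun`, `DiscreteAutomorphicRep.ContainsForm`).

For the unitary group `U(J)` of `(F, E, c)`, an archimedean section `ιinf : U(2,1) →* U(J)(𝔸_F)` with compact factor `Kc`, an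
automorphic measure `μ` and a discrete automorphic representation `P ⊂ L²(U(J)(F)\U(J)(𝔸_F), μ)`: a `(1,0) ⊕ (0,1)` cohomological
cotangent form `Φ ∈ cohForms ιinf Kc = holCotForms ⊔ conj holCotForms` whose coordinates lie in `P` (`P.ContainsForm Φ`) splits as
`Φ = Φ₁ + Φ₂` with `Φ₁` HOLOMORPHIC, `Φ₂` ANTIHOLOMORPHIC and BOTH again in `P`.  READING (folklore representation theory, no
classification of the archimedean component needed): along `ιinf` the holomorphic cotangent forms have right `K_∞`-type the cotangent
isotropy representation `τ = weightOf x₀` of `Stab_{U(2,1)}(x₀) ≅ U(2) × U(1)` and the antiholomorphic ones its complex conjugate `τ̄`;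
the central circle `diag(ζ, ζ, 1)` of `U(2)` acts on `T_{x₀}𝔹² ≅ ℂ²` by the scalar `ζ` resp. `ζ̄`, so `τ` and `τ̄` are DISJOINT, the
two summands are the `τ`- and `τ̄`-ISOTYPIC components of `Φ` under right translation by `ιinf(Stab(x₀))`, and an isotypic component is
`P(v) = dim τ ∫_K χ̄_τ(k) π(k) v dk` ([DeitmarEchterhoff2014, Prop. 7.3.3]) — an average of right translates, coordinate by coordinate,
which preserves every closed invariant subspace of the (right) regular representation ([DeitmarEchterhoff2014, Thm. 7.3.2 (a)];
[BorelJacquet1979, §4.2]: `K`-finite vectors) and square-integrability.  For `U(2,1)` this is the separation of the two `K`-types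
carrying `H^{1,0}` and `H^{0,1}` ([Rogawski1990, §12.3 p. 174, Prop. 15.2.1 (b)]: `J_φ^+`, `J_φ^-`; [BorelWallach2000, VII 2.10]).
Consumed by programme P2's junction J0 (`cotPart ≠ ⊥ → holPart ≠ ⊥ ∨ antiholPart ≠ ⊥`, PLAN-P2 v1.1 §5) together with the engine
letters of ★ `Rogawski1990/CohomologicalSpectrumInnerForm`.  HC_CM is proved only modulo the printed citations until rung 0 closes.

## References
* [DeitmarEchterhoff2014] A. Deitmar, S. Echterhoff, *Principles of Harmonic Analysis*, 2nd ed. (2014), §7.3 Thm. 7.3.2, Prop. 7.3.3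
  (held scan chunk p0199: «the orthogonal projection `P : V_π → V_π(τ)` is given by `P(v) = dim(τ) ∫_K χ̄_τ(x) π(x) v dx`»).
* [BorelJacquet1979] A. Borel, H. Jacquet, Corvallis PSPM 33.1 (1979), §4.2 (right `K`-finiteness), §4.6.
* [Rogawski1990] J. Rogawski, Ann. of Math. Stud. 123 (1990), §12.3 p. 174, Prop. 15.2.1 (b).
* [BorelWallach2000] A. Borel, N. Wallach, 2nd ed. (2000), VII 2.10 (Hodge types of harmonic forms).
-/

noncomputable section

open NumberField MeasureTheory

namespace Literature.NumberTheory.Automorphic.UnitaryGroup.CotangentForms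

open Literature.Geometry.ComplexHyperbolic.BallModel (U21)

/-- **U** (J0) **Hodge splitting inside a discrete automorphic representation.**  For every `(F, E, c, N, J)`, archimedean section
`ιinf : U(2,1) →* U(J)(𝔸_F)`, subgroup `Kc`, automorphic measure `μ`, discrete automorphic representation `P` and every cohomological
cotangent form `Φ ∈ cohForms ιinf Kc` with `P.ContainsForm Φ`, there are `Φ₁ ∈ holCotForms ιinf Kc` and `Φ₂ ∈ conjFun (holCotForms ιinf Kc)`
with `Φ = Φ₁ + Φ₂`, `P.ContainsForm Φ₁` and `P.ContainsForm Φ₂` — `Φ₁`, `Φ₂` are the isotypic components of `Φ` for the DISJOINT right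
`ιinf(Stab x₀)`-types `τ = weightOf x₀` (holomorphic cotangent) and `τ̄` (antiholomorphic), i.e. images of `Φ` under
`dim τ ∫_K χ̄_τ(k) R(ιinf k) dk` resp. the conjugate-type projector, averages of right translates acting coordinatewise, which preserve the
closed invariant subspace `P` of the regular representation and square-integrability. [cite: DeitmarEchterhoff2014, Thm. 7.3.2 (a) and Prop. 7.3.3]
[cite: BorelJacquet1979, §4.2] [cite: Rogawski1990, §12.3 p. 174; Prop. 15.2.1 (b)] [cite: BorelWallach2000, VII 2.10] -/
def cohFormsContainsFormSplit : Prop :=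
  ∀ (F E : Type) [Field F] [NumberField F] [Field E] [NumberField E] [Algebra F E] (c : E ≃ₐ[F] E) (N : ℕ)
    (J : Matrix (Fin N) (Fin N) E) (ιinf : U21 →* (adelicGroupData F E c N J).Adelic)
    (Kc : Subgroup (adelicGroupData F E c N J).Adelic)
    (μ : Measure (adelicGroupData F E c N J).automorphicQuotient) [(adelicGroupData F E c N J).IsAutomorphicMeasure μ]
    (P : DiscreteAutomorphicRep (adelicGroupData F E c N J) μ) (Φ : (adelicGroupData F E c N J).Adelic → (Fin 2 → ℂ)),
    Φ ∈ cohForms F E c N J ιinf Kc → P.ContainsForm Φ →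
      ∃ Φ₁ ∈ holCotForms F E c N J ιinf Kc, ∃ Φ₂ ∈ (holCotForms F E c N J ιinf Kc).map (conjFun F E c N J),
        Φ = Φ₁ + Φ₂ ∧ P.ContainsForm Φ₁ ∧ P.ContainsForm Φ₂

end Literature.NumberTheory.Automorphic.UnitaryGroup.CotangentForms

end
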